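import Mathlib.RingTheory.PowerSeries.Exp
import Mathlib.RingTheory.PowerSeries.Derivative
import Mathlib.Algebra.Module.Rat
import Mathlib.LinearAlgebra.Matrix.Charpoly.Coeff
import Mathlib.LinearAlgebra.Matrix.Adjugate
import Mathlib.LinearAlgebra.Charpoly.ToMatrix
import Literature.AlgebraicGeometry.Motives.FrobeniusTrace
import HarnessLib

/-!
# Cohomological expression of the zeta function — proof

This file discharges the named fact `Literature.AlgebraicGeometry.Motives.GaloisWeilCohomology.zetaSeries_mul_prod_frobCharPoly`
(`Literature/AlgebraicGeometry/Motives/FrobeniusTrace.lean`):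

> if the Galois Weil cohomology theory `E` over the finite field `k` satisfies the Lefschetz
> trace formula `#X(𝔽_{q^m}) = ∑_{i ≤ 2n} (-1)ⁱ tr(Fᵐ | Hⁱ(X))`, then for `X` smooth projective
> of dimension `n`, `Z(X, T) · ∏_{i ≤ 2n even} Pᵢ(X, T) = ∏_{i ≤ 2n odd} Pᵢ(X, T)` in `K⟦T⟧`,
> `Pᵢ(X, T) = det(1 - T·F | Hⁱ(X))`

(Grothendieck, Sém. Bourbaki 279 (1964/65), Cor. 5.2; Deligne, *La conjecture de Weil. I*,
Publ. Math. IHÉS 43 (1974), (1.5.1)–(1.5.4), pp. 275–276; Milne, *Étale cohomology*, Ch. VI,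
Thm. 12.4), as `Literature.AlgebraicGeometry.Motives.GaloisWeilCohomology.zetaSeries_mul_prod_frobCharPoly_holds`.

The printed proof (Deligne, loc. cit.) substitutes the trace formula (1.5.1) into the
logarithmic derivative `t (d/dt) log Z(X₀, t) = ∑_{n > 0} #X₀(𝔽_{qⁿ}) tⁿ` (1.5.2) and applies the
identity of formal power series

> (1.5.3) `t (d/dt) log det(1 - F t, V)⁻¹ = ∑_{n > 0} Tr(Fⁿ, V) tⁿ` for an endomorphism `F` of a
> finite-dimensional vector space `V`

(Milne, *Étale cohomology*, Ch. V, Lemma 2.7: `log det(1 - αt | V)⁻¹ = ∑ Tr(αⁿ | V) tⁿ/n`). We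
follow exactly this route, in the language of Mathlib's formal derivative
`PowerSeries.derivative` (`d⁄dX`) and exponential `PowerSeries.exp`:

1. *Exponentials of power series without constant term* (`Literature.AlgebraicGeometry.Motives.FrobeniusTrace.exp_subst_add`,
   `…exp_subst_sum`): for `f, g ∈ R⟦X⟧` with `f(0) = g(0) = 0` over a commutative `ℚ`-algebra
   `R`, `exp(f + g) = exp(f) exp(g)`, proved by the uniqueness principle
   `PowerSeries.derivative.ext` ("same derivative and same constant term") from the chain rule
   `PowerSeries.derivative_subst` and `PowerSeries.derivative_exp`.
2. *The identity (1.5.3)*, in the integrated form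
   `exp(∑_{m ≥ 1} tr(Aᵐ) Xᵐ/m) · det(1 - X·A) = 1` for a square matrix `A` over a commutative
   `ℚ`-algebra (`Literature.AlgebraicGeometry.Motives.FrobeniusTrace.exp_subst_traceLogSeries_mul_charpolyRev`; here
   `det(1 - X·A) = Matrix.charpolyRev A`). Instead of Deligne's dévissage (dimension one plus
   additivity in short exact sequences, which needs a triangular basis over an algebraic
   closure) we differentiate the determinant directly: by the Leibniz expansion,
   `D det M = ∑ⱼ det(M with column j replaced by D(column j)) = tr(adj(M) · D M)` for any
   derivation `D` (Jacobi's formula, `Literature.AlgebraicGeometry.Motives.FrobeniusTrace.derivation_det_eq_trace`), and for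
   `M = 1 - X·A ∈ Matₙ(R⟦X⟧)` the geometric series `N = ∑ₘ Aᵐ Xᵐ` satisfies `M N = 1`, so
   `adj(M) = det(M) N` and `(d/dX) det(1 - X·A) = -det(1 - X·A) · ∑ₘ tr(Aᵐ⁺¹) Xᵐ`
   (`Literature.AlgebraicGeometry.Motives.FrobeniusTrace.derivative_charpolyRev`, valid over any commutative ring). Hence
   `exp(L_A) · det(1 - X·A)` has zero derivative and constant term `1`, so equals `1`.
3. *Assembly* (`zetaSeries_mul_prod_frobCharPoly_holds`): mapping `Z(X, T) = exp(∑ N_m Tᵐ/m)`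
   to `K⟦T⟧` and inserting the trace formula gives `log Z = ∑_{i even} Lᵢ - ∑_{i odd} Lᵢ` with
   `Lᵢ = ∑_{m ≥ 1} tr(Fᵐ | Hⁱ) Tᵐ/m`; by step 2, `Pᵢ = exp(-Lᵢ)`, and step 1 finishes.

Only `hE`, `E.finite_obj` (finite-dimensionality of `Hⁱ(X)` for smooth projective `X`) and
linear algebra are used, as announced in the docstring of the fact.

## Main results

* `Literature.AlgebraicGeometry.Motives.FrobeniusTrace.exp_subst_add`, `Literature.AlgebraicGeometry.Motives.FrobeniusTrace.exp_subst_sum`: functional equation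
  of `exp ∘ f` for power series `f` without constant term.
* `Literature.AlgebraicGeometry.Motives.FrobeniusTrace.derivation_det_eq_trace`: Jacobi's formula `D(det M) = tr(adj M · D M)`
  for a derivation `D`.
* `Literature.AlgebraicGeometry.Motives.FrobeniusTrace.derivative_charpolyRev`:
  `(d/dX) det(1 - X·A) = -det(1 - X·A) · ∑ₘ tr(Aᵐ⁺¹) Xᵐ` over any commutative ring.
* `Literature.AlgebraicGeometry.Motives.FrobeniusTrace.exp_subst_traceLogSeries_mul_charpolyRev`,
  `Literature.AlgebraicGeometry.Motives.FrobeniusTrace.exp_subst_endTraceLogSeries_mul_reverse_charpoly`: Deligne (1.5.3) /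
  Milne V.2.7, `exp(∑_{m ≥ 1} tr(Aᵐ) Xᵐ/m) · det(1 - X·A) = 1`, for matrices and for
  endomorphisms of finite free modules.
* `Literature.AlgebraicGeometry.Motives.GaloisWeilCohomology.zetaSeries_mul_prod_frobCharPoly_holds`: the discharge.

## References

* A. Grothendieck, *Formule de Lefschetz et rationalité des fonctions L*, Sém. Bourbaki 279
  (1964/65), §5, Cor. 5.2. [Grothendieck1965]
* P. Deligne, *La conjecture de Weil. I*, Publ. Math. IHÉS 43 (1974), (1.5.1)–(1.5.4).
* J. S. Milne, *Étale cohomology*, Princeton Math. Series 33, Ch. V Lemma 2.7, Ch. VI Thm. 12.4.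

## Design notes

* Helper lemmas live in the namespace `Literature.FrobeniusTrace` (the Leibniz rule for finite products
  and the column expansion `derivation_det` are also proved, for another purpose, in
  `Literature/NumberTheory/Automorphic/HarishChandraGLProofs.lean` as `Literature.derivation_finset_prod`,
  `Literature.derivation_det`; that file is not imported here to keep the Motives import graph small,
  and the names below do not clash with it).
* `IsAddTorsionFree R` (needed by `PowerSeries.derivative.ext`) is derived from the `ℚ`-algebra
  structure via `IsAddTorsionFree.of_module_rat` inside the proofs, so the statements carry no
  extra hypothesis.
* The file introduces no definitions: the auxiliary series are written out as
  `PowerSeries.mk fun m => …` (geometric series `∑ₘ Aᵐ Xᵐ`, `L_A = ∑_{m ≥ 1} tr(Aᵐ) Xᵐ/m` with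
  `m`-th coefficient `(m : ℚ)⁻¹ • tr(Aᵐ)`, whose `m = 0` coefficient is `0` since `(0 : ℚ)⁻¹ = 0`).
-/

universe u v

open PowerSeries

noncomputable section

namespace Literature.AlgebraicGeometry.Motives

namespace FrobeniusTrace

/-! ### Exponentials of power series without constant term -/

section ExpSubst

variable {R : Type*} [CommRing R] [Algebra ℚ R]

/-- For `f ∈ R⟦X⟧` with `f(0) = 0`, the composite `exp(f) = (exp R).subst f` has constant term
`1` (only the `d = 0` term of `∑_d f^d/d!` contributes). [folklore] -/
theorem constantCoeff_exp_subst {f : R⟦X⟧} (hf : constantCoeff f = 0) :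
    constantCoeff ((exp R).subst f) = 1 := by
  rw [← coeff_zero_eq_constantCoeff_apply, coeff_subst' (HasSubst.of_constantCoeff_zero' hf),
    finsum_eq_single _ 0]
  · simp
  · intro d hd
    rw [coeff_zero_eq_constantCoeff_apply, map_pow, hf, zero_pow hd, smul_zero]

/-- Chain rule for the exponential: `(exp f)' = exp f · f'` for `f(0) = 0`
(`PowerSeries.derivative_subst`, `PowerSeries.derivative_exp`). [folklore] -/
theorem derivative_exp_subst {f : R⟦X⟧} (hf : constantCoeff f = 0) :
    d⁄dX R ((exp R).subst f) = (exp R).subst f * d⁄dX R f := by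
  rw [derivative_subst R (HasSubst.of_constantCoeff_zero' hf), derivative_exp]

/-- `exp(f) · exp(-f) = 1` for `f ∈ R⟦X⟧` with `f(0) = 0`: both sides have zero derivative and
constant term `1` (`PowerSeries.derivative.ext`). [folklore] -/
theorem exp_subst_mul_exp_subst_neg {f : R⟦X⟧} (hf : constantCoeff f = 0) :
    (exp R).subst f * (exp R).subst (-f) = 1 := by
  haveI := IsAddTorsionFree.of_module_rat (M := R)
  have hf' : constantCoeff (-f) = 0 := by rw [map_neg, hf, neg_zero]
  refine derivative.ext ?_ ?_
  · rw [Derivation.leibniz, derivative_exp_subst hf, derivative_exp_subst hf', map_neg,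
      Derivation.map_one_eq_zero, smul_eq_mul, smul_eq_mul]
    ring
  · rw [map_mul, constantCoeff_exp_subst hf, constantCoeff_exp_subst hf', map_one, mul_one]

/-- **Functional equation of the exponential** for power series without constant term:
`exp(f + g) = exp(f) · exp(g)` in `R⟦X⟧`, `R` a commutative `ℚ`-algebra. Proof: the product
`exp(f + g) · exp(-f) · exp(-g)` has zero derivative and constant term `1`, hence is `1`; now use
`exp_subst_mul_exp_subst_neg`. [folklore] -/
theorem exp_subst_add {f g : R⟦X⟧} (hf : constantCoeff f = 0) (hg : constantCoeff g = 0) :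
    (exp R).subst (f + g) = (exp R).subst f * (exp R).subst g := by
  haveI := IsAddTorsionFree.of_module_rat (M := R)
  have hfg : constantCoeff (f + g) = 0 := by rw [map_add, hf, hg, add_zero]
  have hf' : constantCoeff (-f) = 0 := by rw [map_neg, hf, neg_zero]
  have hg' : constantCoeff (-g) = 0 := by rw [map_neg, hg, neg_zero]
  have hQ : (exp R).subst (f + g) * ((exp R).subst (-f) * (exp R).subst (-g)) = 1 := by
    refine derivative.ext ?_ ?_
    · simp only [Derivation.leibniz, derivative_exp_subst hfg, derivative_exp_subst hf',
        derivative_exp_subst hg', map_neg, map_add, Derivation.map_one_eq_zero, smul_eq_mul]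
      ring
    · simp only [map_mul, constantCoeff_exp_subst hfg, constantCoeff_exp_subst hf',
        constantCoeff_exp_subst hg', map_one, mul_one]
  have h1 := exp_subst_mul_exp_subst_neg hf
  have h2 := exp_subst_mul_exp_subst_neg hg
  calc (exp R).subst (f + g)
      = (exp R).subst (f + g) * (((exp R).subst f * (exp R).subst (-f)) *
          ((exp R).subst g * (exp R).subst (-g))) := by rw [h1, h2, mul_one, mul_one]
    _ = (exp R).subst (f + g) * ((exp R).subst (-f) * (exp R).subst (-g)) *
          ((exp R).subst f * (exp R).subst g) := by ring
    _ = (exp R).subst f * (exp R).subst g := by rw [hQ, one_mul]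

/-- `exp(0) = 1` (substituting `0` keeps only the constant term of `exp`). [folklore] -/
theorem exp_subst_zero : (exp R).subst (0 : R⟦X⟧) = 1 := by
  rw [subst_zero_eq_C_constantCoeff, constantCoeff_exp, map_one, map_one]

/-- `exp(∑_{a ∈ s} f a) = ∏_{a ∈ s} exp(f a)` for power series `f a` without constant term
(induction on `s` from `exp_subst_add`). [folklore] -/
theorem exp_subst_sum {α : Type*} (s : Finset α) (f : α → R⟦X⟧)
    (hf : ∀ a ∈ s, constantCoeff (f a) = 0) :
    (exp R).subst (∑ a ∈ s, f a) = ∏ a ∈ s, (exp R).subst (f a) := by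
  classical
  induction s using Finset.induction_on with
  | empty => rw [Finset.sum_empty, Finset.prod_empty, exp_subst_zero]
  | insert a s ha ih =>
    have hs : ∀ b ∈ s, constantCoeff (f b) = 0 := fun b hb => hf b (Finset.mem_insert_of_mem hb)
    rw [Finset.sum_insert ha, Finset.prod_insert ha,
      exp_subst_add (hf a (Finset.mem_insert_self a s)) ?_, ih hs]
    rw [map_sum]
    exact Finset.sum_eq_zero hs

end ExpSubst

/-! ### Jacobi's formula for derivations -/

section Jacobi

variable {S A : Type*} [CommRing S] [CommRing A] [Algebra S A]

/-- **Leibniz rule for a finite product**: `D (∏_{i ∈ s} f i) = ∑_{i ∈ s} (∏_{j ≠ i} f j) · D (f i)`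
for a derivation `D`. [folklore] -/
theorem derivation_prod (D : Derivation S A A) {α : Type*} [DecidableEq α] (s : Finset α)
    (f : α → A) : D (∏ i ∈ s, f i) = ∑ i ∈ s, (∏ j ∈ s.erase i, f j) * D (f i) := by
  induction s using Finset.induction_on with
  | empty => simp
  | insert a s ha ih =>
    rw [Finset.prod_insert ha, Derivation.leibniz, ih, Finset.sum_insert ha,
      Finset.erase_insert ha, smul_eq_mul, smul_eq_mul, add_comm, Finset.mul_sum]
    congr 1
    refine Finset.sum_congr rfl fun i hi => ?_
    rw [Finset.erase_insert_of_ne (by rintro rfl; exact ha hi),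
      Finset.prod_insert (fun h => ha (Finset.mem_of_mem_erase h)), mul_assoc]

/-- **Derivative of a determinant, column by column**: for a derivation `D` and a square matrix
`M`, `D (det M) = ∑ⱼ det (M with its j-th column replaced by D of that column)` (Leibniz
expansion of `det`). [folklore] -/
theorem derivation_det {m : Type*} [Fintype m] [DecidableEq m] (D : Derivation S A A)
    (M : Matrix m m A) : D M.det = ∑ j, (M.updateCol j fun i => D (M i j)).det := by
  simp only [Matrix.det_apply, map_sum, Units.smul_def, map_zsmul, derivation_prod,
    Finset.smul_sum]
  rw [Finset.sum_comm]
  refine Finset.sum_congr rfl fun j _ => Finset.sum_congr rfl fun σ _ => ?_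
  congr 1
  refine Eq.trans ?_ (Finset.prod_erase_mul Finset.univ _ (Finset.mem_univ j))
  simp only [Matrix.updateCol_self]
  congr 1
  exact Finset.prod_congr rfl fun i hi => by
    simp only [Matrix.updateCol_ne (Finset.ne_of_mem_erase hi)]

/-- **Jacobi's formula**: `D (det M) = tr (adj(M) · D M)` for a derivation `D`, where `D M` is
`D` applied entrywise (column expansion `derivation_det` plus Cramer's rule
`Matrix.cramer_eq_adjugate_mulVec`). [folklore] -/
theorem derivation_det_eq_trace {m : Type*} [Fintype m] [DecidableEq m] (D : Derivation S A A)
    (M : Matrix m m A) : D M.det = (M.adjugate * M.map D).trace := by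
  rw [derivation_det]
  simp only [← Matrix.cramer_apply, Matrix.cramer_eq_adjugate_mulVec, Matrix.trace, Matrix.diag,
    Matrix.mul_apply, Matrix.mulVec, dotProduct, Matrix.map_apply]

end Jacobi

/-! ### The logarithmic derivative of `det(1 - X·A)` -/

section Resolvent

variable {R : Type*} [CommRing R] {ι : Type*} [Fintype ι] [DecidableEq ι]

/-- `[Xᵐ] (A · N)_{ij} = (Aᵐ⁺¹)_{ij}` for the geometric series `N = ∑ₘ Aᵐ Xᵐ ∈ Matₙ(R⟦X⟧)`
(written `Matrix.of fun i j => PowerSeries.mk fun m => (A ^ m) i j`). [folklore] -/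
theorem coeff_map_C_mul_geomSeries (A : Matrix ι ι R) (i j : ι) (m : ℕ) :
    coeff m ((A.map (C : R →+* R⟦X⟧) *
      Matrix.of fun i j => PowerSeries.mk fun m => (A ^ m) i j) i j) = (A ^ (m + 1)) i j := by
  simp only [Matrix.mul_apply, map_sum, Matrix.map_apply, coeff_C_mul, Matrix.of_apply, coeff_mk,
    pow_succ']

/-- `tr (N · A) = ∑ₘ tr(Aᵐ⁺¹) Xᵐ` for the geometric series `N = ∑ₘ Aᵐ Xᵐ`. [folklore] -/
theorem trace_geomSeries_mul_map_C (A : Matrix ι ι R) :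
    ((Matrix.of fun i j => PowerSeries.mk fun m => (A ^ m) i j) *
        A.map (C : R →+* R⟦X⟧)).trace =
      PowerSeries.mk fun m => (A ^ (m + 1)).trace := by
  ext m
  simp only [Matrix.trace, Matrix.diag, Matrix.mul_apply, map_sum, coeff_mk, Matrix.map_apply,
    coeff_mul_C, Matrix.of_apply, pow_succ]

/-- The geometric series inverts `1 - X·A`: `(1 - X·A) · ∑ₘ Aᵐ Xᵐ = 1` in `Matₙ(R⟦X⟧)`.
[folklore] -/
theorem one_sub_smul_mul_geomSeries (A : Matrix ι ι R) :
    (1 - (X : R⟦X⟧) • A.map (C : R →+* R⟦X⟧)) *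
      (Matrix.of fun i j => PowerSeries.mk fun m => (A ^ m) i j) = 1 := by
  ext i j m
  rw [sub_mul, one_mul, Matrix.smul_mul, Matrix.sub_apply, Matrix.smul_apply, map_sub,
    Matrix.of_apply, coeff_mk, smul_eq_mul, Matrix.one_apply]
  cases m with
  | zero =>
    rw [coeff_zero_X_mul, sub_zero, pow_zero, Matrix.one_apply]
    split_ifs <;> simp
  | succ m =>
    rw [coeff_succ_X_mul, coeff_map_C_mul_geomSeries, sub_self]
    split_ifs <;> simp [coeff_one]

/-- `adj(1 - X·A) = det(1 - X·A) · ∑ₘ Aᵐ Xᵐ` (from `adj(M) · M = det M` and `M · N = 1`).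
[folklore] -/
theorem adjugate_one_sub_smul (A : Matrix ι ι R) :
    (1 - (X : R⟦X⟧) • A.map (C : R →+* R⟦X⟧)).adjugate =
      (1 - (X : R⟦X⟧) • A.map (C : R →+* R⟦X⟧)).det •
        (Matrix.of fun i j => PowerSeries.mk fun m => (A ^ m) i j) := by
  have h := one_sub_smul_mul_geomSeries A
  calc (1 - (X : R⟦X⟧) • A.map (C : R →+* R⟦X⟧)).adjugate
      = (1 - (X : R⟦X⟧) • A.map (C : R →+* R⟦X⟧)).adjugate *
          ((1 - (X : R⟦X⟧) • A.map (C : R →+* R⟦X⟧)) *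
            Matrix.of fun i j => PowerSeries.mk fun m => (A ^ m) i j) := by
        rw [h, mul_one]
    _ = (1 - (X : R⟦X⟧) • A.map (C : R →+* R⟦X⟧)).adjugate *
          (1 - (X : R⟦X⟧) • A.map (C : R →+* R⟦X⟧)) *
            Matrix.of fun i j => PowerSeries.mk fun m => (A ^ m) i j := (mul_assoc _ _ _).symm
    _ = (1 - (X : R⟦X⟧) • A.map (C : R →+* R⟦X⟧)).det •
          (Matrix.of fun i j => PowerSeries.mk fun m => (A ^ m) i j) := by
        rw [Matrix.adjugate_mul, Matrix.smul_mul, one_mul]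

/-- `det(1 - X·A) ∈ R⟦X⟧` is (the image of) the reversed characteristic polynomial
`Matrix.charpolyRev A = det(1 - X·A) ∈ R[X]`. [folklore] -/
theorem det_one_sub_smul (A : Matrix ι ι R) :
    (1 - (X : R⟦X⟧) • A.map (C : R →+* R⟦X⟧)).det = (A.charpolyRev : R⟦X⟧) := by
  have h : (1 - (X : R⟦X⟧) • A.map (C : R →+* R⟦X⟧)) =
      (Polynomial.coeToPowerSeries.ringHom : Polynomial R →+* R⟦X⟧).mapMatrix
        (1 - (Polynomial.X : Polynomial R) • A.map Polynomial.C) := by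
    refine Matrix.ext fun i j => ?_
    simp only [RingHom.mapMatrix_apply, Matrix.map_apply, Matrix.sub_apply, Matrix.one_apply,
      Matrix.smul_apply, smul_eq_mul, map_sub, map_mul,
      Polynomial.coeToPowerSeries.ringHom_apply, Polynomial.coe_X, Polynomial.coe_C]
    split_ifs <;> simp
  rw [h, ← RingHom.map_det, Matrix.charpolyRev, Polynomial.coeToPowerSeries.ringHom_apply]

omit [Fintype ι] in
/-- The entrywise derivative of `1 - X·A` is `-A`. [folklore] -/
theorem map_derivative_one_sub_smul (A : Matrix ι ι R) :
    (1 - (X : R⟦X⟧) • A.map (C : R →+* R⟦X⟧)).map (d⁄dX R) = -A.map (C : R →+* R⟦X⟧) := by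
  refine Matrix.ext fun i j => ?_
  simp only [Matrix.map_apply, Matrix.sub_apply, Matrix.one_apply, Matrix.smul_apply,
    Matrix.neg_apply, smul_eq_mul, map_sub, Derivation.leibniz, derivative_C, derivative_X]
  split_ifs <;> simp

/-- **Logarithmic derivative of the reversed characteristic polynomial** (Deligne, *Weil I*
(1974), (1.5.3), differentiated form; Milne, *Étale cohomology*, V Lemma 2.7): over any
commutative ring, `(d/dX) det(1 - X·A) = -det(1 - X·A) · ∑_{m ≥ 0} tr(Aᵐ⁺¹) Xᵐ` in `R⟦X⟧`.
Proof: Jacobi's formula and `adj(1 - X·A) = det(1 - X·A) ∑ₘ Aᵐ Xᵐ`. [folklore] -/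
theorem derivative_charpolyRev (A : Matrix ι ι R) :
    d⁄dX R (A.charpolyRev : R⟦X⟧) =
      -((A.charpolyRev : R⟦X⟧) * PowerSeries.mk fun m => (A ^ (m + 1)).trace) := by
  rw [← det_one_sub_smul, derivation_det_eq_trace, adjugate_one_sub_smul,
    map_derivative_one_sub_smul, Matrix.mul_neg, Matrix.trace_neg, Matrix.smul_mul,
    Matrix.trace_smul, smul_eq_mul, trace_geomSeries_mul_map_C]

end Resolvent

/-! ### `exp (∑ tr(Aᵐ) Xᵐ / m) · det(1 - X·A) = 1` -/

section ExpTrace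

variable {R : Type*} [CommRing R] [Algebra ℚ R] {ι : Type*} [Fintype ι] [DecidableEq ι]

/-- The series `L_A = ∑_{m ≥ 1} tr(Aᵐ) Xᵐ / m ∈ R⟦X⟧` (`R` a `ℚ`-algebra), written
`PowerSeries.mk fun m => (m : ℚ)⁻¹ • (A ^ m).trace` (the coefficient of `X⁰` is
`(0 : ℚ)⁻¹ • tr(1) = 0`), has no constant term. [folklore] -/
theorem constantCoeff_traceLogSeries (A : Matrix ι ι R) :
    constantCoeff (PowerSeries.mk fun m => (m : ℚ)⁻¹ • (A ^ m).trace : R⟦X⟧) = 0 := by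
  rw [← coeff_zero_eq_constantCoeff_apply, coeff_mk, Nat.cast_zero, inv_zero, zero_smul]

/-- `L_A' = ∑_{m ≥ 0} tr(Aᵐ⁺¹) Xᵐ` for `L_A = ∑_{m ≥ 1} tr(Aᵐ) Xᵐ / m`. [folklore] -/
theorem derivative_traceLogSeries (A : Matrix ι ι R) :
    d⁄dX R (PowerSeries.mk fun m => (m : ℚ)⁻¹ • (A ^ m).trace) =
      PowerSeries.mk fun m => (A ^ (m + 1)).trace := by
  ext m
  rw [coeff_derivative, coeff_mk, coeff_mk, ← Nat.cast_succ, ← nsmul_eq_mul',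
    ← Nat.cast_smul_eq_nsmul ℚ, smul_smul,
    mul_inv_cancel₀ (Nat.cast_ne_zero.mpr (Nat.succ_ne_zero m)), one_smul]

/-- **Deligne (1.5.3) / Milne V.2.7, matrix form**: for a square matrix `A` over a commutative
`ℚ`-algebra `R`, `exp (∑_{m ≥ 1} tr(Aᵐ) Xᵐ / m) · det(1 - X·A) = 1` in `R⟦X⟧`, i.e.
`det(1 - X·A)⁻¹ = exp (∑_{m ≥ 1} tr(Aᵐ) Xᵐ / m)` (`det(1 - X·A) = Matrix.charpolyRev A`). Proof: by
`derivative_charpolyRev` the left-hand side has zero derivative, and its constant term is `1`.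
[folklore] -/
theorem exp_subst_traceLogSeries_mul_charpolyRev (A : Matrix ι ι R) :
    (exp R).subst (PowerSeries.mk fun m => (m : ℚ)⁻¹ • (A ^ m).trace) *
      (A.charpolyRev : R⟦X⟧) = 1 := by
  haveI := IsAddTorsionFree.of_module_rat (M := R)
  refine derivative.ext ?_ ?_
  · rw [Derivation.leibniz, smul_eq_mul, smul_eq_mul, derivative_charpolyRev,
      derivative_exp_subst (constantCoeff_traceLogSeries A), derivative_traceLogSeries,
      Derivation.map_one_eq_zero]
    ring
  · rw [map_mul, constantCoeff_exp_subst (constantCoeff_traceLogSeries A), one_mul, map_one,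
      Polynomial.constantCoeff_coe, Polynomial.coeff_zero_eq_eval_zero, Matrix.eval_charpolyRev]

end ExpTrace

/-! ### The same for endomorphisms of finite free modules -/

section End

variable {R : Type*} [CommRing R] [Algebra ℚ R] {M : Type*} [AddCommGroup M] [Module R M]

/-- In a basis `b`, `L_f = ∑_{m ≥ 1} tr(fᵐ) Xᵐ / m` equals `L_A` for the matrix `A` of the
endomorphism `f` (`LinearMap.trace_eq_matrix_trace`, `LinearMap.toMatrix_pow`). [folklore] -/
theorem endTraceLogSeries_eq_traceLogSeries {ι : Type*} [Fintype ι] [DecidableEq ι]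
    (b : Module.Basis ι R M) (f : M →ₗ[R] M) :
    (PowerSeries.mk fun m => (m : ℚ)⁻¹ • LinearMap.trace R M (f ^ m) : R⟦X⟧) =
      PowerSeries.mk fun m => (m : ℚ)⁻¹ • (LinearMap.toMatrix b b f ^ m).trace := by
  ext m
  rw [coeff_mk, coeff_mk, LinearMap.trace_eq_matrix_trace R b, LinearMap.toMatrix_pow]

variable [Module.Free R M] [Module.Finite R M]

/-- **Deligne (1.5.3) / Milne V.2.7**: for an endomorphism `f` of a finite free module over a
commutative `ℚ`-algebra `R`, `exp (∑_{m ≥ 1} tr(fᵐ) Xᵐ / m) · det(1 - X·f) = 1` in `R⟦X⟧`,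
where `det(1 - X·f)` is the reverse of the characteristic polynomial `LinearMap.charpoly f`
(`Matrix.reverse_charpoly`) and `tr = LinearMap.trace`. [folklore] -/
theorem exp_subst_endTraceLogSeries_mul_reverse_charpoly (f : M →ₗ[R] M) :
    (exp R).subst (PowerSeries.mk fun m => (m : ℚ)⁻¹ • LinearMap.trace R M (f ^ m)) *
      (f.charpoly.reverse : R⟦X⟧) = 1 := by
  classical
  let b := Module.Free.chooseBasis R M
  rw [← LinearMap.charpoly_toMatrix f b, Matrix.reverse_charpoly,
    endTraceLogSeries_eq_traceLogSeries b]
  exact exp_subst_traceLogSeries_mul_charpolyRev _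

end End

end FrobeniusTrace

/-! ### The discharge -/

namespace GaloisWeilCohomology

open FrobeniusTrace

variable {k : Type u} [Field k] [Finite k] {K : Type v} [Field K] [CharZero K]
  {χ : Field.absoluteGaloisGroup k →* Kˣ} (E : GaloisWeilCohomology k K χ)

/-- **Deligne (1.5.3) for `F | Hⁱ(X)`**: for `X` smooth projective and
`Lᵢ(X, T) = ∑_{m ≥ 1} tr(Fᵐ | Hⁱ(X)) Tᵐ / m ∈ K⟦T⟧` (written
`PowerSeries.mk fun m => (m : ℚ)⁻¹ • E.frobTracePow X i m`),
`exp (Lᵢ(X, T)) · Pᵢ(X, T) = 1` in `K⟦T⟧`, `Pᵢ(X, T) = det(1 - T·F | Hⁱ(X))`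
(`Hⁱ(X)` is finite dimensional by `E.finite_obj`). [folklore] -/
theorem exp_subst_mul_frobCharPoly {n : ℕ} {X : SchemeOver k} (hX : IsSmoothProjective n X)
    (i : ℕ) :
    (exp K).subst (PowerSeries.mk fun m => (m : ℚ)⁻¹ • E.frobTracePow X i m) *
      (E.frobCharPoly X i : PowerSeries K) = 1 := by
  haveI := E.finite_obj hX i
  rw [E.frobCharPoly_of_finite X i]
  exact exp_subst_endTraceLogSeries_mul_reverse_charpoly _

/-- Hence `Pᵢ(X, T) = exp (-Lᵢ(X, T))` for `X` smooth projective (Deligne, *Weil I* (1974),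
(1.5.3)–(1.5.4)). [folklore] -/
theorem frobCharPoly_eq_exp_subst_neg {n : ℕ} {X : SchemeOver k} (hX : IsSmoothProjective n X)
    (i : ℕ) :
    (E.frobCharPoly X i : PowerSeries K) =
      (exp K).subst (-PowerSeries.mk fun m => (m : ℚ)⁻¹ • E.frobTracePow X i m) := by
  have h0 : constantCoeff (PowerSeries.mk fun m => (m : ℚ)⁻¹ • E.frobTracePow X i m) = 0 := by
    rw [← coeff_zero_eq_constantCoeff_apply, coeff_mk, Nat.cast_zero, inv_zero, zero_smul]
  have h1 := E.exp_subst_mul_frobCharPoly hX i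
  have h2 := exp_subst_mul_exp_subst_neg h0
  calc (E.frobCharPoly X i : PowerSeries K)
      = (exp K).subst (PowerSeries.mk fun m => (m : ℚ)⁻¹ • E.frobTracePow X i m) *
          (exp K).subst (-PowerSeries.mk fun m => (m : ℚ)⁻¹ • E.frobTracePow X i m) *
          (E.frobCharPoly X i : PowerSeries K) := by rw [h2, one_mul]
    _ = (exp K).subst (-PowerSeries.mk fun m => (m : ℚ)⁻¹ • E.frobTracePow X i m) *
          ((exp K).subst (PowerSeries.mk fun m => (m : ℚ)⁻¹ • E.frobTracePow X i m) *
            (E.frobCharPoly X i : PowerSeries K)) := by ring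
    _ = (exp K).subst (-PowerSeries.mk fun m => (m : ℚ)⁻¹ • E.frobTracePow X i m) := by
          rw [h1, mul_one]

/-- **The trace formula, integrated** (Deligne, *Weil I* (1974), (1.5.1)–(1.5.2)): under the
Lefschetz trace formula, `log Z(X, T) = ∑_{i ≤ 2n} (-1)ⁱ Lᵢ(X, T)` in `K⟦T⟧` for `X` smooth
projective of dimension `n`, `Lᵢ(X, T) = ∑_{m ≥ 1} tr(Fᵐ | Hⁱ(X)) Tᵐ / m`. [folklore] -/
theorem map_logZetaSeries (hE : E.HasLefschetzTraceFormula) {n : ℕ} {X : SchemeOver k}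
    (hX : IsSmoothProjective n X) :
    (logZetaSeries X).map (algebraMap ℚ K) =
      ∑ i ∈ Finset.range (2 * n + 1),
        C ((-1 : K) ^ i) * PowerSeries.mk fun m => (m : ℚ)⁻¹ • E.frobTracePow X i m := by
  ext m
  simp only [coeff_map, coeff_logZetaSeries, map_sum, coeff_C_mul, coeff_mk, Rat.smul_def,
    Rat.cast_inv, Rat.cast_natCast]
  split_ifs with hm
  · simp [hm]
  · rw [map_div₀, map_natCast, map_natCast, hE hX m (Nat.pos_of_ne_zero hm), Finset.sum_div]
    exact Finset.sum_congr rfl fun i _ => by rw [mul_div_assoc, div_eq_inv_mul]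

/-- `log Z(X, T) = ∑_{i even} Lᵢ(X, T) - ∑_{i odd} Lᵢ(X, T)` (`0 ≤ i ≤ 2n`) under the trace
formula (Deligne, *Weil I* (1974), (1.5.4), logarithmic form). [folklore] -/
theorem map_logZetaSeries_eq_sub (hE : E.HasLefschetzTraceFormula) {n : ℕ} {X : SchemeOver k}
    (hX : IsSmoothProjective n X) :
    (logZetaSeries X).map (algebraMap ℚ K) =
      ∑ i ∈ (Finset.range (2 * n + 1)) with Even i,
          (PowerSeries.mk fun m => (m : ℚ)⁻¹ • E.frobTracePow X i m : PowerSeries K) -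
        ∑ i ∈ (Finset.range (2 * n + 1)) with Odd i,
          (PowerSeries.mk fun m => (m : ℚ)⁻¹ • E.frobTracePow X i m : PowerSeries K) := by
  rw [E.map_logZetaSeries hE hX,
    ← Finset.sum_filter_add_sum_filter_not (Finset.range (2 * n + 1)) (fun i => Even i),
    sub_eq_add_neg, ← Finset.sum_neg_distrib]
  congr 1
  · exact Finset.sum_congr rfl fun i hi => by
      rw [(Finset.mem_filter.mp hi).2.neg_one_pow, map_one, one_mul]
  · refine Finset.sum_congr (Finset.filter_congr fun i _ => Nat.not_even_iff_odd) fun i hi => ?_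
    rw [(Finset.mem_filter.mp hi).2.neg_one_pow, map_neg, map_one, neg_one_mul]

/-- **Cohomological expression of the zeta function** (Grothendieck, Sém. Bourbaki 279
(1964/65), Cor. 5.2; Deligne, *La conjecture de Weil. I* (1974), (1.5.4); Milne, *Étale
cohomology*, VI Thm. 12.4): discharge of the named fact
`Literature.AlgebraicGeometry.Motives.GaloisWeilCohomology.zetaSeries_mul_prod_frobCharPoly` — if `E` satisfies the Lefschetz
trace formula then `Z(X, T) · ∏_{i even} Pᵢ(X, T) = ∏_{i odd} Pᵢ(X, T)` in `K⟦T⟧` for `X` smooth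
projective of dimension `n` (`0 ≤ i ≤ 2n`). Proof: `Z = exp(∑_{even} Lᵢ - ∑_{odd} Lᵢ)`
(`map_logZetaSeries_eq_sub`), `Pᵢ = exp(-Lᵢ)` (`frobCharPoly_eq_exp_subst_neg`, i.e. Deligne
(1.5.3)) and the functional equation of `exp` (`FrobeniusTrace.exp_subst_add`).
[cite: Grothendieck1965, Cor. 5.2] -/
theorem zetaSeries_mul_prod_frobCharPoly_holds : E.zetaSeries_mul_prod_frobCharPoly := by
  intro hE n X hX
  -- `Lᵢ(X, T) = ∑_{m ≥ 1} tr(Fᵐ | Hⁱ(X)) Tᵐ / m`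
  set L : ℕ → PowerSeries K := fun i => PowerSeries.mk fun m => (m : ℚ)⁻¹ • E.frobTracePow X i m
    with hLdef
  have hL : ∀ i, constantCoeff (L i) = 0 := fun i => by
    rw [hLdef, ← coeff_zero_eq_constantCoeff_apply, coeff_mk, Nat.cast_zero, inv_zero, zero_smul]
  have hLn : ∀ i, constantCoeff (-L i) = 0 := fun i => by rw [map_neg, hL, neg_zero]
  -- `Z(X, T)` mapped to `K⟦T⟧` is `exp (log Z)`
  have hZ : (zetaSeries X).map (algebraMap ℚ K) =
      (exp K).subst ((logZetaSeries X).map (algebraMap ℚ K)) := by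
    have h := PowerSeries.map_subst (hasSubst_logZetaSeries X) (h := algebraMap ℚ K) (exp ℚ)
    rw [map_exp] at h
    exact h
  -- the products of the `Pᵢ` are exponentials
  have hprod : ∀ (p : ℕ → Prop) [DecidablePred p],
      ∏ i ∈ (Finset.range (2 * n + 1)) with p i, (E.frobCharPoly X i : PowerSeries K) =
        (exp K).subst (-∑ i ∈ (Finset.range (2 * n + 1)) with p i, L i) := by
    intro p _
    rw [← Finset.sum_neg_distrib, exp_subst_sum _ _ fun i _ => hLn i]
    exact Finset.prod_congr rfl fun i _ => E.frobCharPoly_eq_exp_subst_neg hX i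
  have hev : constantCoeff (∑ i ∈ (Finset.range (2 * n + 1)) with Even i, L i -
      ∑ i ∈ (Finset.range (2 * n + 1)) with Odd i, L i) = 0 := by
    rw [map_sub, map_sum, map_sum, Finset.sum_eq_zero fun i _ => hL i,
      Finset.sum_eq_zero fun i _ => hL i, sub_zero]
  have hev' : constantCoeff (-∑ i ∈ (Finset.range (2 * n + 1)) with Even i, L i) = 0 := by
    rw [map_neg, map_sum, Finset.sum_eq_zero fun i _ => hL i, neg_zero]
  have hlog := E.map_logZetaSeries_eq_sub hE hX
  simp only [← hLdef] at hlog
  rw [hZ, hlog, hprod, hprod, ← exp_subst_add hev hev']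
  congr 1
  ring

end GaloisWeilCohomology

end Literature.AlgebraicGeometry.Motives

end
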